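import Literature.NumberTheory.GaloisRepresentations.CMTypeHeckeCharacter
import Literature.NumberTheory.EllipticCurves.HeegnerPoints
import HarnessLib

/-!
# Rohrlich's theorem on `L`-functions of CM Hecke characters in anticyclotomic towers
# (Rohrlich, Invent. Math. 75 (1984) 383–408, Theorem p. 384; Jia, Acta Arith. 2026, Thm. 1)

Topic `Literature/NumberTheory/EllipticCurves`; sibling of `RohrlichNonvanishing.lean` (the CYCLOTOMIC
paper, Invent. Math. 75 (1984) 409–423, Dirichlet twists of weight-2 newforms). Cell `bsd-goldfeld`,
typer seat `bsd-goldfeld-ty` g3 (D-0074 row (J): "BCST Thm A (20045) / LTYZ Thm 1.1 (19141)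
hypotheses typed statements-first at `p = 2`, `K = ℚ(√−7)`, the R1 audit's lines"). ONE named fact
(`def … : Prop`, cited, nothing asserted; D-0014) + definitions with bodies + proved bookkeeping.

## Why this file (the R1 line it types)

The printed proof of Burungale–Castella–Skinner–Tian 2022, Thm. A (tree fact
`BurungaleCastellaSkinnerTian2022.thmA_analyticRank_eq_one_of_selmerCorank_eq_one`, route item
20045) obtains at Thm. 7.1 (i) (p. 341) the `Λ`-non-torsionness of the Heegner class `z_{f,χ}` from
"[5, Thm. 1.1]" = Burungale–Disegni, AIF 70 (2020), whose standing hypothesis "`p ∤ 2 D_F h_E^−`"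
EXCLUDES `p = 2` (cell memo `HOME/R1-AUDIT.md` §1, row "Thm 7.1 (i)"; module docstring of
`BurungaleCastellaSkinnerTian2022/CMPConverse.lean`, "Proof status at `p = 2`"). The in-print
substitute valid at `p = 2` is the purely complex-analytic theorem of this file: generic central
(non-)vanishing of `L(s, φρ)` over ALL anticyclotomic twists `ρ` of the CM character `φ` unramified
outside a finite set `P` of rational primes — and "the fact that `P` may contain the prime `2` and
primes of bad reduction for `E` leads to a slight artificiality in some of the arguments of §2"
(Rohrlich 1984, p. 385): `P ∋ 2` IS allowed. The same theorem is the generic-non-vanishing input of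
anticyclotomic Iwasawa theory of CM curves at every prime: Agboola–Howard, AIF 56 (2006), proof of the
non-triviality of the Katz measures ("`W_{ϑψ} = 1`. It now follows from a theorem of Rohrlich (see
page 384 of [rohrlich]) that, for all but finitely many choices of `ϑ`, we have
`L_{∞,𝔣𝔭*}(ϑψ, 1) ≠ 0`", arXiv math/0302319 p. 11) and of the Mordell–Weil growth ("By a theorem of
Rohrlich [rohrlich], there are only finitely many characters `ρ` of `Δ_∞` such that the derivative
`L′(ψρ, 1) = 0`", ibid. p. 22) — i.e. BCST's Route-B inputs (2)–(3) (p. 327) — and of Li–Xu, JNT 293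
(2027), Thm. 1.1. It does NOT make item 20045 provable: BCST Thm. 5.1 (the `Λ`-adic explicit
reciprocity law) remains unprinted at `p = 2` (R1-AUDIT §1/§7/§9; TY-HYPOTHESES-AT-TWO §3).

## Sources (read for this file) and the statement as printed

* [Jia2026ActaArith] H. Jia, *On `L`-functions of Hecke characters and anticyclotomic towers*, Acta
  Arith. (2026), doi:10.4064/aa241210-23-10 = arXiv:2412.05867 (held: `paper:arxiv-2412.05867`,
  3000-character chunks `p0002`–`p0006` read 2026-08-26). §1 (chunk p0003): "`K` an imaginary
  quadratic field with class number `h` … We say `M/K` is anticyclotomic if the nontrivial element of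
  Gal(`K/ℚ`) acts on Gal(`M/K`) by inversion. Let `P` be a fixed finite set of rational primes. Let
  `L` be the compositum of all anticyclotomic extensions of `K` which are unramified outside `P` …
  `φ` a Hecke character … of `K` with infinite type (1,0) … We say `φ` is equivariant … if for all
  integral ideal `𝔞` of `K`, we have `φ(𝔞̄) = \overline{φ(𝔞)}` … For a given finite order character
  `ρ : Gal(L/K) → ℂ^×`, we view it as an idele class character … let `φρ` denote the primitive Hecke
  character given by their product. Let `X = {χ | χ = φρ for some finite order character ρ of
  Gal(L/K)}` … in the functional equation `Λ(s,χ) = W(χ)Λ(2−s, χ̄) = W(χ)Λ(2−s, χ)` the root number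
  `W(χ) = 1` or `−1` … **Theorem 1.** For all but finitely many `χ ∈ X`,
  `ord_{s=1} L(s,χ) = 0` if `W(χ) = 1`, `= 1` if `W(χ) = −1`." and "Our result is a generalization of
  Rohrlich [Roh84a] … Rohrlich has actually proved the case when class number `h` of `K` is 1 …
  [for] Hecke characters given by elliptic curves". §2 (chunk p0005), (3)–(5):
  "`A = (2π)⁻¹ |discriminant of K|^{1/2}`, `f = f(χ) = (N𝔣(χ))^{1/2}`, `Λ(s,χ) = Γ(s)(Af)^s L(s,χ)`.
  The functional equation is `Λ(s,χ) = W(χ)Λ(2−s,χ)`", `L(s,χ) = Σ_𝔞 χ(𝔞) N𝔞^{−s}` (§1).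
* [Rohrlich1984Anticyclotomic] D. E. Rohrlich, Invent. Math. 75 (1984) 383–408 — the ORIGINAL
  (`K` of class number one, `φ` the Hecke character of a CM elliptic curve `E/ℚ`, `L(s, E/ℚ) = L(s, φ)`).
  The primary is paywalled for this seat (acq-10839, open); its Theorem (p. 384) and the `P ∋ 2`
  sentence (p. 385) were read FIRST-HAND by the cell's literature seat on the Göttingen digitisation
  (R1-AUDIT.md §1, 2026-08-25: "Rohrlich's Theorem (p. 384) «For all but finitely many χ in X,
  ord_{s=1} L(s,χ) = 0 if W(χ) = 1, = 1 if W(χ) = −1», X = {φρ : ρ a character of Gal(L/K)},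
  L = maximal anticyclotomic extension of K unramified outside a finite set P of rational primes").
  Per the reconstruct rule this file is typed from the refereed secondary that RESTATES and PROVES
  the result in greater generality (Jia, Thm. 1; `lit reconstruct acq-10839`), citing both.
* [LiXu2025JNT] H. Li, R. Xu, JNT 293 (2027) 1–41 = arXiv:2502.12648, Thm. 1.1 "(Rohrlich, Jia)"
  (held, chunk p0003): the same statement, with "anticyclotomic means `φ ∘ c = φ̄`".
* [AgboolaHoward2006] A. Agboola, B. Howard, AIF 56 (2006), pp. 11 and 22 of arXiv math/0302319
  (held): the two consumer shapes quoted above.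

## Transcription (idelic; every notion is the tree's `GaloisRepresentations.HeckeCharacter`)

* `K` imaginary quadratic: `IsImaginaryQuadratic K` (`HeegnerPoints.lean`); its complex conjugation is
  the non-trivial `c : K ≃ₐ[ℚ] K` (binder `c ≠ 1`), acting on ideles (`Automorphic/GaloisActionAdeleRing`)
  and on Hecke characters by `HeckeCharacter.galConj c χ = χ ∘ (c • ·)` (`CMTypeHeckeCharacter.lean`).
* "`φ` of infinite type (1,0)" (`φ((α)) = α` for `α ≡ 1 mod 𝔣`, Jia §2: "`φ(w𝒪) = ε₁(w) w`"): the
  tree's `φ.HasInfinityType (fun _ ↦ 1) (fun _ ↦ 0)` — idelically `φ((z, 1)) = ι_w(z)⁻¹` at the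
  unique infinite place `w`, which is the idelic form of the ideal-theoretic type `(1, 0)` with
  respect to the embedding `ι_w` chosen by Mathlib (dictionary `HeckeCharacterOfGrossencharakter`,
  `PrimaryGeneratorHeckeCharacter.embType`: "`(1, 0)` at the place of `e` if its chosen embedding is
  `e`, `(0, 1)` if it is `ē`"). A consumer holding `φ` of tree type `(0, 1)` applies the fact to
  `galConj c φ` (type `(1, 0)`, `HasInfinityType.galConj_complexConj`).
* "equivariant" `φ(𝔞̄) = \overline{φ(𝔞)}`: idelically `φ(c • x) = \overline{φ(x)}` for every idele
  `x` (`IsHeckeConjEquivariant c φ`). [Ideal ⇒ idelic: both `galConj c φ` and `conj ∘ φ` are Hecke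
  characters of type `(0, 1)` agreeing at the uniformisers of all unramified places, hence equal;
  idelic ⇒ ideal: `valueAtUniformizer_galConj_of_isUnramifiedAt`.] Equivalently (Jia §2, Property 1;
  abstract): the restriction of `φ` to `ℚ` is the quadratic character of `K` (times the norm).
* "`ρ` a finite-order character of Gal(`L/K`), viewed as an idele class character": a finite-order
  Hecke character `ρ` (`ρ.IsFiniteOrder`) that is ANTICYCLOTOMIC, `ρ ∘ c = ρ⁻¹`
  (`IsAnticyclotomicCharacter c ρ`: by class field theory `rec(c • x) = c̃ rec(x) c̃⁻¹`, so `ρ`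
  factors through the largest quotient of Gal(`K^{ab}/K`) on which `c` acts by inversion, i.e.
  through Gal(`L_∞/K`) for `L_∞` the compositum of all anticyclotomic extensions; its kernel's fixed
  field is then a finite anticyclotomic extension) and UNRAMIFIED OUTSIDE the places above `P`
  (`IsUnramifiedOutsideNat P ρ`, with the tree's `HeckeCharacter.IsUnramifiedAt`). The family `X` is
  indexed by `ρ` (`ρ ↦ φρ` is injective): `anticyclotomicTwistFamily c P`.
* "`L(s, χ)`", `χ = φρ` primitive: the tree's `heckeLFunction (φ * ρ) s = ∏_{v ∤ 𝔣(φρ)} (1 − (φρ)(ϖ_v)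
  N v^{−s})⁻¹` (Euler product over the unramified places of the product = the primitive `L`-series
  `Σ χ(𝔞) N𝔞^{−s}`; `|χ(𝔭)| = N𝔭^{1/2}` for type `(1,0)`, so this is the genuine value for `re s > 3/2`).
* "`ord_{s=1} L(s,χ) = 0`, resp. `= 1`": some (equivalently every — identity theorem) entire
  continuation `F` of `s ↦ L(s, χ)` from `re s > 3/2` has `F(1) ≠ 0`, resp. `F(1) = 0 ≠ F′(1)`
  (`CentralValueNeZero`, `HasSimpleCentralZero`; `L(s, χ)` IS entire — Hecke — but that is not
  asserted here).
* "`W(χ) = ±1`": `IsCentralRootNumber χ W` — there are `B > 0` and an entire `Λ` with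
  `Λ(s) = Γ(s) B^s L(s, χ)` for `re s > 3/2` and `Λ(s) = W Λ(2 − s)` for all `s` (Jia (5) with
  `B = A f = (2π)⁻¹ (|d_K| N𝔣(χ))^{1/2}`). The constant `B` is quantified existentially instead of
  being spelled `(2π)⁻¹(|d_K| N𝔣(χ))^{1/2}` (the tree has no conductor ideal of an idelic Hecke
  character); this does not weaken the notion: if `Γ(s)B^s L(s,χ)` satisfies the sign-`W` equation
  and `Γ(s)B′^s L(s,χ)` the sign-`W′` equation then `(B′/B)^{2s−2} = W′/W` identically, forcing
  `B′ = B` and `W′ = W` because `L(s, χ) ≢ 0` (Euler product). Hence for `χ ∈ X`,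
  `IsCentralRootNumber χ 1` (resp. `(−1)`) holds iff the printed `W(χ)` is `1` (resp. `−1`), and the
  typed dichotomy below is implied by (indeed equivalent to) the printed one.

## What is here

* Definitions (bodies, no facts): `IsHeckeConjEquivariant`, `IsAnticyclotomicCharacter`,
  `IsUnramifiedOutsideNat`, `anticyclotomicTwistFamily`, `IsEntireContinuationWt2`,
  `CentralValueNeZero`, `HasSimpleCentralZero`, `IsCentralRootNumber`, `RohrlichDichotomy`.
* The named fact `RohrlichJia_centralOrder_anticyclotomicTwists` (Jia Thm. 1 ⊇ Rohrlich's Theorem).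
* Proved bookkeeping: closure of anticyclotomic characters under `1`, `⁻¹`, `*`; monotonicity of the
  family in `P`; the fact for `P ⊆ P′` from the fact for `P′`; the one-prime form `P = {p}` (ANY
  prime `p`, in particular `p = 2`: characters of `p`-power conductor — the shape consumed by
  Agboola–Howard 2006 and by BCST 2022 Thm. 7.1 (i)).

## What is NOT here (and why)

* No `_holds`: the proof (Shimura's algebraicity `L(1, χ^σ) = 0 ⟺ L(1, χ) = 0` and its Gross–Zagier
  analogue for `L′`, Galois averaging over `X`, and Ridout's `p`-adic Roth theorem; Rohrlich §§2–3,
  Jia §§2–5) needs special-value algebraicity for CM Hecke `L`-functions and Diophantine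
  approximation absent from Mathlib and the tree. SIZE XL; not attempted (typer seat).
* The functional equation itself (existence of `W(χ) ∈ {±1}` for `χ ∈ X`) and the root-number
  formula (Jia (9), Miyake Thm. 3.3.1) are separate classical facts (Hecke–Tate: tree
  `heckeLFunction_functional_equation`, unitary normalisation), not restated here.
* No elliptic-curve corollary (`L(E/ℚ, s) = L(s, φ_E)` for `E/ℚ` with CM by `𝒪_K`, Deuring): the
  tree's Deuring dictionary (`Deuring_LFunction_baseChange_cmField`) is Grössencharakter-free and the
  Hecke character OF a CM curve is not a tree object; consumers instantiate `φ` themselves (for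
  `K = ℚ(√−7)`, `E = X₀(49)`: `φ` of conductor `(√−7)`, `PrimaryGeneratorHeckeCharacter`).
* Greenberg's earlier theorem (Invent. Math. 72 (1983), `P = {p}` ordinary) and Rohrlich's 1989
  ramified-at-`N` refinements are not vendored.

## References

* [Rohrlich1984Anticyclotomic] Theorem (p. 384); p. 383 (`L`, `X`); p. 385 (`P ∋ 2` allowed); §§2–3.
* [Jia2026ActaArith] Thm. 1 (§1); §1 (anticyclotomic, `L`, `X`, equivariant, `W(χ) = ±1`); §2
  Property 1, (3)–(5) (`A`, `f`, `Λ`, functional equation), (9) (root number formula).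
* [LiXu2025JNT] Thm. 1.1 "(Rohrlich, Jia)"; §1 ("anticyclotomic means `φ ∘ c = φ̄`").
* [AgboolaHoward2006] §3 (non-triviality of `μ_𝔭`, `μ_{𝔭*}`: "page 384 of [rohrlich]"), App. (rank growth).
* [BurungaleCastellaSkinnerTian2022] Thm. 7.1 (i) (p. 341) and ref. [5] (the `p`-odd input replaced here).
-/

noncomputable section

open scoped ComplexConjugate
open NumberField IsDedekindDomain
open Literature.NumberTheory.Automorphic Literature.NumberTheory.GaloisRepresentations

namespace Literature.NumberTheory.EllipticCurves

section Definitions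

variable {K : Type} [Field K] [NumberField K]

/-! ### Anticyclotomic twists: the family `X` -/

/-- **`φ` is equivariant with respect to complex conjugation** (Jia 2026, §1: "`φ(𝔞̄) = \overline{φ(𝔞)}`
for all integral ideals `𝔞`"; Li–Xu: "`φ ∘ c = φ̄`"), in idelic form: `φ(c • x) = \overline{φ(x)}` for
every idele `x`, where `c` is (meant to be) the complex conjugation of the imaginary quadratic field
`K` acting on `𝕀_K` and `χ ∘ (c • ·)` is the tree's `HeckeCharacter.galConj c χ`. For `φ` of infinity
type `(1, 0)` this is equivalent to the ideal-theoretic condition (module docstring) and to "the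
restriction of `φ` to `ℚ` is the quadratic character of `K`" (Jia §2, Property 1). A predicate on
`(c, φ)`, not a fact. [cite: Jia2026ActaArith, §1 (equivariant Hecke characters) and §2 Property 1] -/
def IsHeckeConjEquivariant (c : K ≃ₐ[ℚ] K) (φ : HeckeCharacter K) : Prop :=
  ∀ x : ideleGroup K, ((HeckeCharacter.galConj c φ x : ℂˣ) : ℂ) = conj ((φ x : ℂˣ) : ℂ)

/-- **`ρ` is an anticyclotomic character**: `ρ ∘ c = ρ⁻¹` as Hecke characters (`c` the complex
conjugation of `K` acting on ideles). Jia 2026, §1: "`M/K` is anticyclotomic if the nontrivial element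
of Gal(`K/ℚ`) acts on Gal(`M/K`) by inversion"; an idele class character factors through (a finite
sub-extension of) the compositum of all anticyclotomic extensions iff `ρ(c • x) = ρ(x)⁻¹`, since the
reciprocity map intertwines `c • ·` on `𝕀_K/K^×` with conjugation by a lift of `c` on Gal(`K^{ab}/K`)
(module docstring). A predicate, not a fact. [cite: Jia2026ActaArith, §1 (anticyclotomic extensions, the field L)] -/
def IsAnticyclotomicCharacter (c : K ≃ₐ[ℚ] K) (ρ : HeckeCharacter K) : Prop :=
  HeckeCharacter.galConj c ρ = ρ⁻¹

/-- **`ρ` is unramified outside (the places above) `P`**, `P` a finite set of natural numbers (meant: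
rational primes): `ρ` is unramified (`HeckeCharacter.IsUnramifiedAt`, trivial on `𝒪_vˣ`) at every
finite place `v` of `K` lying above no element of `P`. (Jia 2026, §1: "`L` … the compositum of all
anticyclotomic extensions of `K` which are unramified outside `P`" — characters of Gal(`L/K`) are the
anticyclotomic characters unramified outside `P`; no condition at the complex place.) A predicate.
[cite: Jia2026ActaArith, §1 (the field L)] -/
def IsUnramifiedOutsideNat (P : Finset ℕ) (ρ : HeckeCharacter K) : Prop :=
  ∀ v : HeightOneSpectrum (𝓞 K), (∀ p ∈ P, (p : 𝓞 K) ∉ v.asIdeal) → ρ.IsUnramifiedAt v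

/-- **The index set of Rohrlich's family `X`**: the finite-order anticyclotomic Hecke characters `ρ`
of `K` unramified outside `P` ("finite order characters `ρ` of Gal(`L/K`)", Jia 2026 §1; Rohrlich 1984
p. 383), so that `X = {φρ : ρ ∈ anticyclotomicTwistFamily c P}` and `ρ ↦ φρ` is a bijection onto `X`.
[cite: Jia2026ActaArith, §1 (the set X)] [cite: Rohrlich1984Anticyclotomic, p. 383] -/
def anticyclotomicTwistFamily (c : K ≃ₐ[ℚ] K) (P : Finset ℕ) : Set (HeckeCharacter K) :=
  {ρ | ρ.IsFiniteOrder ∧ IsAnticyclotomicCharacter c ρ ∧ IsUnramifiedOutsideNat P ρ}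

/-! ### Central order and root number in the weight-two normalisation (centre `s = 1`) -/

/-- `F` is an **entire continuation of `L(s, χ)` from the half-plane `re s > 3/2`**, where
`L(s, χ) = ∏_{v ∤ 𝔣(χ)} (1 − χ(ϖ_v) N v^{−s})⁻¹` is the tree's `heckeLFunction χ s` (for `χ` of infinity
type `(1, 0)` times a finite-order character, `|χ(ϖ_v)| = N v^{1/2}` and the product converges
absolutely there; Jia 2026 §1: `L(s,χ) = Σ_𝔞 χ(𝔞) N𝔞^{−s}`). Such an `F` is unique if it exists
(identity theorem). A predicate on `(χ, F)`. [cite: Jia2026ActaArith, §1–§2 (L(s,χ))] -/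
def IsEntireContinuationWt2 (χ : HeckeCharacter K) (F : ℂ → ℂ) : Prop :=
  Differentiable ℂ F ∧ ∀ s : ℂ, 3 / 2 < s.re → F s = heckeLFunction χ s

/-- **`ord_{s=1} L(s, χ) = 0`**: an entire continuation of `L(s, χ)` (from `re s > 3/2`) does not
vanish at the central point `s = 1` (Jia 2026, Thm. 1, case `W(χ) = 1`: "`L(1, χ) ≠ 0`", §2
"`L^{(v)}(1,χ) ≠ 0`" with `v = 0`). [cite: Jia2026ActaArith, Thm. 1 and §2] -/
def CentralValueNeZero (χ : HeckeCharacter K) : Prop :=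
  ∃ F : ℂ → ℂ, IsEntireContinuationWt2 χ F ∧ F 1 ≠ 0

/-- **`ord_{s=1} L(s, χ) = 1`**: an entire continuation `F` of `L(s, χ)` has a simple zero at the
central point, `F(1) = 0` and `F′(1) ≠ 0` (Jia 2026, Thm. 1, case `W(χ) = −1`; §2 "`L^{(v)}(1,χ) ≠ 0`"
with `v = 1`; Agboola–Howard 2006: "only finitely many characters `ρ` … such that the derivative
`L′(ψρ, 1) = 0`"). [cite: Jia2026ActaArith, Thm. 1 and §2] -/
def HasSimpleCentralZero (χ : HeckeCharacter K) : Prop :=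
  ∃ F : ℂ → ℂ, IsEntireContinuationWt2 χ F ∧ F 1 = 0 ∧ deriv F 1 ≠ 0

/-- **`W` is the root number of `χ` in the weight-two normalisation** (Jia 2026, §2 (3)–(5):
"`A = (2π)⁻¹|d_K|^{1/2}`, `f = (N𝔣(χ))^{1/2}`, `Λ(s,χ) = Γ(s)(Af)^s L(s,χ)`. The functional equation
is `Λ(s,χ) = W(χ)Λ(2−s,χ)`"; for the equivariant `χ` of the theorem `L(s, χ̄) = L(s, χ)`, §1, so the
equation is self-dual and `W(χ) ∈ {1, −1}`): there are a constant `B > 0` and an ENTIRE function `Λ`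
with `Λ(s) = Γ(s) B^s L(s, χ)` for `re s > 3/2` and `Λ(s) = W · Λ(2 − s)` for all `s`. The printed
`B = A f` is quantified existentially (the tree has no conductor ideal of an idelic Hecke character);
since `L(s, χ) ≢ 0`, at most one pair `(B, W)` can satisfy this, so the predicate singles out the
printed `W(χ)` (module docstring, "Transcription", last item). A predicate on `(χ, W)`; the
functional equation (existence of such `W`) is NOT asserted. [cite: Jia2026ActaArith, §2 (3)–(5)] -/
def IsCentralRootNumber (χ : HeckeCharacter K) (W : ℂ) : Prop :=
  ∃ B : ℝ, 0 < B ∧ ∃ Λ : ℂ → ℂ, Differentiable ℂ Λ ∧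
    (∀ s : ℂ, 3 / 2 < s.re → Λ s = Complex.Gamma s * (B : ℂ) ^ s * heckeLFunction χ s) ∧
    ∀ s : ℂ, Λ s = W * Λ (2 - s)

/-- **Rohrlich's dichotomy for one character `χ`** (the conclusion of Rohrlich 1984, Theorem p. 384 /
Jia 2026, Thm. 1 at `χ`): if the root number is `+1` then `L(1, χ) ≠ 0`, and if it is `−1` then
`L(s, χ)` has a simple zero at `s = 1`. [cite: Jia2026ActaArith, Thm. 1] [cite: Rohrlich1984Anticyclotomic, Theorem (p. 384)] -/
def RohrlichDichotomy (χ : HeckeCharacter K) : Prop :=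
  (IsCentralRootNumber χ 1 → CentralValueNeZero χ) ∧
    (IsCentralRootNumber χ (-1) → HasSimpleCentralZero χ)

end Definitions

/-! ### The named fact -/

/-- **Rohrlich 1984 (Theorem, p. 384) — Jia 2026 (Thm. 1): the central order of `L(s, φρ)` over an
anticyclotomic tower is generically `0` or `1` according to the root number.** Verbatim (Jia, Acta
Arith. 2026, Thm. 1, with §1): let `K` be an imaginary quadratic field (any class number), `P` a
finite set of rational primes, `L` the compositum of all anticyclotomic extensions of `K` unramified
outside `P`, `φ` a Hecke character of `K` of infinite type `(1, 0)` equivariant with respect to complex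
conjugation, and `X = {φρ : ρ a finite-order character of Gal(L/K)}`; "For all but finitely many
`χ ∈ X`, `ord_{s=1} L(s, χ) = 0` if `W(χ) = 1`, `= 1` if `W(χ) = −1`." Rohrlich, Invent. Math. 75
(1984), Theorem p. 384, is the case `h(K) = 1`, `φ` the Hecke character of a CM elliptic curve `E/ℚ`
(`L(s, E/ℚ) = L(s, φ)`); there (p. 385) "`P` may contain the prime `2` and primes of bad reduction for
`E`". Transcription (module docstring): `K` with `IsImaginaryQuadratic K` and complex conjugation
`c ≠ 1`; `φ.HasInfinityType (1, 0)` (tree convention, w.r.t. Mathlib's embedding of the infinite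
place) and `IsHeckeConjEquivariant c φ`; the exceptional `ρ` — finite order, anticyclotomic
(`ρ ∘ c = ρ⁻¹`), unramified outside `P`, for which the dichotomy `RohrlichDichotomy (φ * ρ)` FAILS —
form a finite set. `P` is an ARBITRARY finite set (in particular `P = {2}`, or `P ∋ 2` together with
the primes of bad reduction). No `_holds`: the proof (Shimura algebraicity of `L(1, χ^σ)`, Galois
averaging, Ridout's `p`-adic Roth theorem) is beyond the tree. PUBLISHED and refereed (Jia: Acta
Arith. 2026; Rohrlich: Invent. Math. 1984); restated as Li–Xu, JNT 293 (2027), Thm. 1.1.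
[cite: Jia2026ActaArith, Thm. 1 (§1)] [cite: Rohrlich1984Anticyclotomic, Theorem (p. 384) and p. 385]
[cite: LiXu2025JNT, Thm. 1.1] -/
def RohrlichJia_centralOrder_anticyclotomicTwists : Prop :=
  ∀ (K : Type) [Field K] [NumberField K] (_hK : IsImaginaryQuadratic K) (c : K ≃ₐ[ℚ] K) (_hc : c ≠ 1)
    (φ : HeckeCharacter K) (_hφ : φ.HasInfinityType (fun _ ↦ 1) (fun _ ↦ 0))
    (_heq : IsHeckeConjEquivariant c φ) (P : Finset ℕ),
    Set.Finite {ρ : HeckeCharacter K | ρ ∈ anticyclotomicTwistFamily c P ∧ ¬ RohrlichDichotomy (φ * ρ)}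

/-! ### Bookkeeping (proved) -/

section API

variable {K : Type} [Field K] [NumberField K]

/-- Pointwise form of `IsAnticyclotomicCharacter`: `ρ(c • x) = ρ(x)⁻¹` ("the nontrivial element of
Gal(`K/ℚ`) acts … by inversion"). [cite: Jia2026ActaArith, §1 (anticyclotomic extensions)] -/
theorem isAnticyclotomicCharacter_iff_forall (c : K ≃ₐ[ℚ] K) (ρ : HeckeCharacter K) :
    IsAnticyclotomicCharacter c ρ ↔ ∀ x : ideleGroup K, ρ (c • x) = (ρ x)⁻¹ := by
  unfold IsAnticyclotomicCharacter
  constructor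
  · intro h x
    have := congrArg (fun χ : HeckeCharacter K ↦ χ x) h
    simpa only [HeckeCharacter.galConj_apply, HeckeCharacter.inv_apply] using this
  · intro h
    ext x
    rw [HeckeCharacter.galConj_apply, HeckeCharacter.inv_apply, h x]

/-- The trivial character is anticyclotomic (`K` itself lies in `L`).
[cite: Jia2026ActaArith, §1 (the field L)] -/
theorem isAnticyclotomicCharacter_one (c : K ≃ₐ[ℚ] K) :
    IsAnticyclotomicCharacter c (1 : HeckeCharacter K) := by
  rw [isAnticyclotomicCharacter_iff_forall]
  intro x
  rw [HeckeCharacter.one_apply, HeckeCharacter.one_apply, inv_one]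

/-- Anticyclotomic characters are closed under inversion (characters of Gal(`L/K`) form a group).
[cite: Jia2026ActaArith, §1 (the field L)] -/
theorem IsAnticyclotomicCharacter.inv {c : K ≃ₐ[ℚ] K} {ρ : HeckeCharacter K}
    (h : IsAnticyclotomicCharacter c ρ) : IsAnticyclotomicCharacter c ρ⁻¹ := by
  unfold IsAnticyclotomicCharacter at h ⊢
  rw [HeckeCharacter.galConj_inv, h]

/-- Anticyclotomic characters are closed under products (the compositum of anticyclotomic extensions
is anticyclotomic: "`L` the compositum of all anticyclotomic extensions").
[cite: Jia2026ActaArith, §1 (the field L)] -/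
theorem IsAnticyclotomicCharacter.mul {c : K ≃ₐ[ℚ] K} {ρ ρ' : HeckeCharacter K}
    (h : IsAnticyclotomicCharacter c ρ) (h' : IsAnticyclotomicCharacter c ρ') :
    IsAnticyclotomicCharacter c (ρ * ρ') := by
  unfold IsAnticyclotomicCharacter at h h' ⊢
  rw [HeckeCharacter.galConj_mul, h, h', mul_inv]

/-- Enlarging `P` relaxes the ramification condition (`L_P ⊆ L_{P'}` for `P ⊆ P'`).
[cite: Jia2026ActaArith, §1 (the field L)] -/
theorem IsUnramifiedOutsideNat.mono {P P' : Finset ℕ} (hPP' : P ⊆ P') {ρ : HeckeCharacter K}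
    (h : IsUnramifiedOutsideNat P ρ) : IsUnramifiedOutsideNat P' ρ :=
  fun v hv ↦ h v fun p hp ↦ hv p (hPP' hp)

/-- The family `X` grows with `P` (`L_P ⊆ L_{P'}`, so `X_P ⊆ X_{P'}`).
[cite: Jia2026ActaArith, §1 (the set X)] -/
theorem anticyclotomicTwistFamily_mono (c : K ≃ₐ[ℚ] K) {P P' : Finset ℕ} (hPP' : P ⊆ P') :
    anticyclotomicTwistFamily c P ⊆ anticyclotomicTwistFamily c P' :=
  fun _ ⟨h₁, h₂, h₃⟩ ↦ ⟨h₁, h₂, h₃.mono hPP'⟩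

/-- The trivial Hecke character is unramified everywhere. [folklore] -/
private theorem isUnramifiedAt_one_heckeCharacter (v : HeightOneSpectrum (𝓞 K)) :
    (1 : HeckeCharacter K).IsUnramifiedAt v :=
  fun _ ↦ rfl

/-- The trivial twist belongs to every family `X`, i.e. `φ` itself is a member of `X` (`ρ = 1`).
[cite: Jia2026ActaArith, §1 (the set X)] -/
theorem one_mem_anticyclotomicTwistFamily (c : K ≃ₐ[ℚ] K) (P : Finset ℕ) :
    (1 : HeckeCharacter K) ∈ anticyclotomicTwistFamily c P :=
  ⟨show IsOfFinOrder (1 : HeckeCharacter K) from IsOfFinOrder.one, isAnticyclotomicCharacter_one c,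
    fun v _ ↦ isUnramifiedAt_one_heckeCharacter v⟩

end API

namespace RohrlichJia_centralOrder_anticyclotomicTwists

variable {K : Type} [Field K] [NumberField K]

/-- **The exceptional set only shrinks when `P` shrinks**: granted the fact, for `P ⊆ P'` the
exceptional characters of the `P`-family are among those of the `P'`-family (used to pass from "all
primes dividing `pN`" to `{p}`). [cite: Jia2026ActaArith, Thm. 1] -/
theorem finite_of_subset (h : RohrlichJia_centralOrder_anticyclotomicTwists)
    (hK : IsImaginaryQuadratic K) {c : K ≃ₐ[ℚ] K} (hc : c ≠ 1) {φ : HeckeCharacter K}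
    (hφ : φ.HasInfinityType (fun _ ↦ 1) (fun _ ↦ 0)) (heq : IsHeckeConjEquivariant c φ)
    {P P' : Finset ℕ} (hPP' : P ⊆ P') :
    Set.Finite {ρ : HeckeCharacter K |
      ρ ∈ anticyclotomicTwistFamily c P ∧ ¬ RohrlichDichotomy (φ * ρ)} :=
  (h K hK c hc φ hφ heq P').subset fun _ ⟨hρ, hno⟩ ↦
    ⟨anticyclotomicTwistFamily_mono c hPP' hρ, hno⟩

/-- **One-prime form (`P = {p}`, ANY prime `p`, e.g. `p = 2`)** — the shape consumed in
anticyclotomic Iwasawa theory (Agboola–Howard 2006, §3 and App.: characters of the anticyclotomic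
`ℤ_p`-extension / of `p`-power conductor; Burungale–Castella–Skinner–Tian 2022, Thm. 7.1 (i)): granted
the fact, among the finite-order anticyclotomic characters `ρ` of `K` unramified outside the primes
above `p`, all but finitely many satisfy: `W(φρ) = 1 ⟹ L(1, φρ) ≠ 0` and
`W(φρ) = −1 ⟹ ord_{s=1} L(s, φρ) = 1`. [cite: Jia2026ActaArith, Thm. 1]
[cite: Rohrlich1984Anticyclotomic, Theorem (p. 384) and p. 385] [cite: AgboolaHoward2006, §3] -/
theorem finite_primePower (h : RohrlichJia_centralOrder_anticyclotomicTwists)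
    (hK : IsImaginaryQuadratic K) {c : K ≃ₐ[ℚ] K} (hc : c ≠ 1) {φ : HeckeCharacter K}
    (hφ : φ.HasInfinityType (fun _ ↦ 1) (fun _ ↦ 0)) (heq : IsHeckeConjEquivariant c φ) (p : ℕ) :
    Set.Finite {ρ : HeckeCharacter K | ρ.IsFiniteOrder ∧ IsAnticyclotomicCharacter c ρ ∧
      (∀ v : HeightOneSpectrum (𝓞 K), (p : 𝓞 K) ∉ v.asIdeal → ρ.IsUnramifiedAt v) ∧
      ¬ RohrlichDichotomy (φ * ρ)} := by
  refine (h K hK c hc φ hφ heq {p}).subset fun ρ ⟨h₁, h₂, h₃, hno⟩ ↦ ⟨⟨h₁, h₂, ?_⟩, hno⟩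
  intro v hv
  exact h₃ v (hv p (Finset.mem_singleton_self p))

/-- **Both halves separately, one-prime form.** Granted the fact: (a) only finitely many `ρ` in the
`{p}`-family have root number `+1` and `L(1, φρ) = 0` [in the sense `¬ CentralValueNeZero`];
(b) only finitely many have root number `−1` and fail to have a simple zero at `s = 1`
(Agboola–Howard 2006: "for all but finitely many choices of `ϑ`, `L(ϑψ, 1) ≠ 0`"; "only finitely
many characters `ρ` of `Δ_∞` such that the derivative `L′(ψρ, 1) = 0`").
[cite: AgboolaHoward2006, §3 and App.] [cite: Jia2026ActaArith, Thm. 1] -/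
theorem finite_signPlus_and_signMinus (h : RohrlichJia_centralOrder_anticyclotomicTwists)
    (hK : IsImaginaryQuadratic K) {c : K ≃ₐ[ℚ] K} (hc : c ≠ 1) {φ : HeckeCharacter K}
    (hφ : φ.HasInfinityType (fun _ ↦ 1) (fun _ ↦ 0)) (heq : IsHeckeConjEquivariant c φ)
    (P : Finset ℕ) :
    Set.Finite {ρ : HeckeCharacter K | ρ ∈ anticyclotomicTwistFamily c P ∧
        IsCentralRootNumber (φ * ρ) 1 ∧ ¬ CentralValueNeZero (φ * ρ)} ∧
      Set.Finite {ρ : HeckeCharacter K | ρ ∈ anticyclotomicTwistFamily c P ∧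
        IsCentralRootNumber (φ * ρ) (-1) ∧ ¬ HasSimpleCentralZero (φ * ρ)} := by
  have hfin := h K hK c hc φ hφ heq P
  refine ⟨hfin.subset fun ρ ⟨hρ, hW, hL⟩ ↦ ⟨hρ, fun hd ↦ hL (hd.1 hW)⟩,
    hfin.subset fun ρ ⟨hρ, hW, hL⟩ ↦ ⟨hρ, fun hd ↦ hL (hd.2 hW)⟩⟩

end RohrlichJia_centralOrder_anticyclotomicTwists

end Literature.NumberTheory.EllipticCurves
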